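import Summits.ValiantsHypothesis.ValiantsHypothesis.Theorems.LacunarySymmetroidMatrixDescartesCensusDoorA34TouchUnfolding

/-!
# `MatrixDescartes` census — DOOR A at `(3,4)`: any-touch unfolding through an ARBITRARY letter, and the NULL-NULL sheet's A′ bridge

HONEST FRAMING.  Object-search cell `pub-symmetroid`, engine seat `val-sym-eng-2` (g13); helper row beside the registered strata line
`Cruxes/DoorA34/Lines/strata.lean` on stmt-ValiantsHypothesis-19980 (`DoorA34 = PosRootLawAt 3 4 18`: OPEN, typed, never asserted here), stubs
`stub_nullTopCeiling` (`det S₃ = 0 ⇒ ≤ 17`) and `stub_nullNullCeiling` (`det S₀ = det S₃ = 0 ⇒ ≤ 16`).  PRIOR ART: the tree's A′ BRIDGE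
(…CensusDoorA34Lift, `exists_nineteen_of_eighteen_of_countP`: 17 simple + 1 double ⇒ a nineteen, deforming `S₀` at orders 1/2/3) and its chain-currency /
every-chain-length form …CensusDoorA34TouchUnfolding (this seat, ✓ p732066, deforming `S₀`).  Deforming the BOTTOM letter destroys `det S₀ = 0`, so the
null-null stratum needs the same statement with the deformation on a MIDDLE letter.  This file proves it for an ARBITRARY letter `l₀`:

* §1 `le_card_posRoots_cubicFamily_of_touch₁` — the first-order member of the family lemmas of p732066 (`A₁(ρ) ≠ 0`; the sign of `c` steers).
* §2 `eval_pencil_perturb_letter`, `eval_det_pencil_perturb_letter` — `S_{l₀} ↦ S_{l₀} + c·E` changes `det` at `x` by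
  `c·x^{d_{l₀}} tr(adj F(x)·E) + c²·x^{2d_{l₀}} tr(adj E·F(x)) + c³·x^{3d_{l₀}} det E` (tree `det_add_smul_fin_three`).
* §3 ★ `card_posRoots_perturb_letter_ge_of_touch_any` — chain of `N + 1` points + a flanked touching zero ⇒ for every letter index `l₀` a SYMMETRIC `E` and a
  `c` with `≥ N + 2` distinct positive det-roots after `S_{l₀} ↦ S_{l₀} + c·E` (orders 1/2/3 exactly as in the A′ bridge; directions from …DoorA34Lift).
* §4 ★ THE NULL-NULL SHEET'S A′ BRIDGE `seventeen_on_nullNull_of_chain_touch_any`: `det S₀ = det S₃ = 0`, a chain of 16 positive points (15 crossings) and a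
  flanked touching zero ⇒ a symmetric pencil with `det S'₀ = det S'₃ = 0` and `≥ 17` distinct positive det-roots (deform `S₁`) — the configuration
  `stub_nullNullCeiling` must exclude; and the null-top version through `S₁` (`eighteen_on_sheet_of_chain_touch_any'`).

Nothing here bounds any count; `DoorA34` and all three stubs stay OPEN; registers unchanged (`ζ_sym(3,4) ∈ {18,19}`); nothing on `MatrixDescartes`
(stmt-ValiantsHypothesis-18050) or `VP ≠ VNP` — VP≠VNP not moved.  [folklore] As in the A′ bridge; elementary.
-/

-- `Summit.ValiantsHypothesis.ValiantsHypothesis.…` repeats a component by the D-0017 layout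
-- (single-conjunct summit), which the `dupNamespace` linter flags; the name is mandated.
set_option linter.dupNamespace false

namespace Summit.ValiantsHypothesis.ValiantsHypothesis.Theorems.LacunarySymmetroidMatrixDescartes.Census

open Polynomial Finset
open scoped BigOperators Polynomial Matrix
open Summit.ValiantsHypothesis.ValiantsHypothesis.Theorems.MatrixDescartes.Negative (PosRootLawAt)

/-! ## §1 The first-order member of the cubic-family lemmas -/

/-- **First-order unfolding of a touch** (cubic family, `A₁(ρ) ≠ 0`; the sign of `c` steers, the higher terms are dominated). [folklore] -/
theorem le_card_posRoots_cubicFamily_of_touch₁ {p : ℝ[X]} {N : ℕ} {s : ℝ} {a : Fin (N + 1) → ℝ} (h : AltChain p N s a) (k : Fin (N + 1))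
    {u ρ v : ℝ} (hu0 : 0 < u) (huρ : u < ρ) (hρv : ρ < v)
    (hlo : ∀ j : Fin (N + 1), j.val + 1 = k.val → a j < u) (hhi : ∀ j : Fin (N + 1), j.val = k.val + 1 → v < a j)
    (hpu : 0 < p.eval (a k) * p.eval u) (hpρ : p.eval ρ = 0) (hpv : 0 < p.eval (a k) * p.eval v)
    (g : ℝ → ℝ[X]) (A₁ A₂ A₃ : ℝ → ℝ) (hg : ∀ c x, (g c).eval x = p.eval x + c * A₁ x + c ^ 2 * A₂ x + c ^ 3 * A₃ x)
    (h1 : A₁ ρ ≠ 0) :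
    ∃ c : ℝ, N + 2 ≤ ((g c).roots.toFinset.filter (fun t => 0 < t)).card := by
  classical
  set P : Finset ℝ := (Finset.univ.image a) ∪ {u, v} with hP
  have hpak : p.eval (a k) ≠ 0 := le_card_posRoots_add_C_mul_of_touch.altChain_eval_ne_zero' h k
  have hpne : ∀ x ∈ P, p.eval x ≠ 0 := by
    intro x hx
    rcases Finset.mem_union.mp hx with hx | hx
    · obtain ⟨j, -, rfl⟩ := Finset.mem_image.mp hx
      exact le_card_posRoots_add_C_mul_of_touch.altChain_eval_ne_zero' h j
    · rcases Finset.mem_insert.mp hx with rfl | hx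
      · intro h0; rw [h0, mul_zero] at hpu; exact lt_irrefl _ hpu
      · rw [Finset.mem_singleton] at hx; subst hx
        intro h0; rw [h0, mul_zero] at hpv; exact lt_irrefl _ hpv
  obtain ⟨δ, hδ, hδ1, hδb, hsmall⟩ :=
    exists_small_delta P ⟨u, by simp [hP]⟩ p A₁ A₂ A₃ hpne (|A₁ ρ| / (|A₂ ρ| + |A₃ ρ| + 1)) (div_pos (abs_pos.mpr h1) (by positivity))
  -- sign of `c`: opposite to `p(a_k)·A₁(ρ)`
  set σ : ℝ := if 0 < p.eval (a k) * A₁ ρ then -1 else 1 with hσ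
  have hσabs : |σ| = 1 := by rw [hσ]; split_ifs <;> simp
  have hσsq : σ ^ 2 = 1 := by rw [hσ]; split_ifs <;> norm_num
  have hσsign : σ * (p.eval (a k) * A₁ ρ) < 0 := by
    rw [hσ]; split_ifs with hq
    · linarith
    · have : p.eval (a k) * A₁ ρ < 0 := lt_of_le_of_ne (not_lt.mp hq) (mul_ne_zero hpak h1)
      linarith
  refine ⟨σ * δ, ?_⟩
  have hcabs : |σ * δ| ≤ δ := by rw [abs_mul, hσabs, one_mul, abs_of_pos hδ]
  have hkeep : ∀ x ∈ P, 0 < p.eval x * (g (σ * δ)).eval x := by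
    intro x hx
    have := mul_add_pos_of_abs_lt (hsmall x hx (σ * δ) hcabs)
    rw [hg]; convert this using 2; ring
  refine le_card_posRoots_replace_triple h k hu0 huρ hρv hlo hhi (fun j _ => hkeep _ (by simp [hP])) ?_ ?_ ?_
  · exact le_card_posRoots_add_C_mul_of_touch.pos_of_mul_pos_both (hkeep u (by simp [hP])) hpu hpak
  · rw [hg, hpρ]
    -- `(σδ)·A₁ + (σδ)²·A₂ + (σδ)³·A₃ = σδ·(A₁ + σδ·A₂ + δ²·A₃)` and `|σδ·A₂ + δ²·A₃| < |A₁|`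
    have hrest : |σ * δ * A₂ ρ + δ ^ 2 * A₃ ρ| < |A₁ ρ| := by
      have hden : 0 < |A₂ ρ| + |A₃ ρ| + 1 := by positivity
      have hb := (lt_div_iff₀ hden).mp hδb
      have hd2 : δ ^ 2 ≤ δ := by nlinarith
      calc |σ * δ * A₂ ρ + δ ^ 2 * A₃ ρ| ≤ |σ * δ * A₂ ρ| + |δ ^ 2 * A₃ ρ| := abs_add_le _ _
        _ = δ * |A₂ ρ| + δ ^ 2 * |A₃ ρ| := by
            rw [abs_mul, abs_mul, abs_mul, hσabs, one_mul, abs_of_pos hδ, abs_of_pos (by positivity : 0 < δ ^ 2)]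
        _ ≤ δ * |A₂ ρ| + δ * |A₃ ρ| := by nlinarith [abs_nonneg (A₃ ρ)]
        _ < |A₁ ρ| := by nlinarith [abs_nonneg (A₂ ρ), abs_nonneg (A₃ ρ)]
    have hsame : 0 < A₁ ρ * (A₁ ρ + (σ * δ * A₂ ρ + δ ^ 2 * A₃ ρ)) := mul_add_pos_of_abs_lt hrest
    have s2 : (σ * δ) ^ 2 = δ ^ 2 := by rw [mul_pow, hσsq, one_mul]
    have s3 : (σ * δ) ^ 3 = σ * δ ^ 3 := by
      rw [mul_pow, show σ ^ 3 = σ by rw [pow_succ, hσsq, one_mul]]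
    have e : p.eval (a k) * (0 + σ * δ * A₁ ρ + (σ * δ) ^ 2 * A₂ ρ + (σ * δ) ^ 3 * A₃ ρ)
        = δ * (σ * p.eval (a k) * (A₁ ρ + (σ * δ * A₂ ρ + δ ^ 2 * A₃ ρ))) := by
      rw [s2, s3]; linear_combination (-(δ ^ 2 * p.eval (a k) * A₂ ρ)) * hσsq
    have hneg : σ * p.eval (a k) * (A₁ ρ + (σ * δ * A₂ ρ + δ ^ 2 * A₃ ρ)) < 0 := by
      have e1 := mul_neg_of_neg_of_pos hσsign hsame
      have e2 : σ * (p.eval (a k) * A₁ ρ) * (A₁ ρ * (A₁ ρ + (σ * δ * A₂ ρ + δ ^ 2 * A₃ ρ)))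
          = A₁ ρ ^ 2 * (σ * p.eval (a k) * (A₁ ρ + (σ * δ * A₂ ρ + δ ^ 2 * A₃ ρ))) := by ring
      rw [e2] at e1
      by_contra hc
      exact absurd e1 (not_lt.mpr (mul_nonneg (sq_nonneg _) (not_lt.mp hc)))
    rw [e]
    exact mul_neg_of_pos_of_neg hδ hneg
  · exact le_card_posRoots_add_C_mul_of_touch.pos_of_mul_pos_both (hkeep v (by simp [hP])) hpv hpak

/-! ## §2 The pencil family `S_{l₀} ↦ S_{l₀} + c·E` -/

/-- evaluating the pencil perturbed in letter `l₀`: `Σ x^{d_l}(S_l + [l = l₀]·c·E) = F(x) + (c·x^{d_{l₀}})·E`. [folklore] -/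
theorem eval_pencil_perturb_letter (l₀ : Fin 4) (d : Fin 4 → ℕ) (S : Fin 4 → Matrix (Fin 3) (Fin 3) ℝ) (E : Matrix (Fin 3) (Fin 3) ℝ) (c x : ℝ) :
    (∑ l, x ^ d l • (S l + if l = l₀ then c • E else 0)) = (∑ l, x ^ d l • S l) + (c * x ^ d l₀) • E := by
  have hsplit : ∀ l : Fin 4, x ^ d l • (S l + if l = l₀ then c • E else 0) = x ^ d l • S l + (if l = l₀ then (c * x ^ d l₀) • E else 0) := by
    intro l
    split_ifs with hl
    · subst hl; rw [smul_add, smul_smul, mul_comm]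
    · rw [add_zero, add_zero]
  simp_rw [hsplit, Finset.sum_add_distrib, Finset.sum_ite_eq', Finset.mem_univ, if_true]

/-- the cubic family of the letter-`l₀` perturbation at a point `x`. [folklore] -/
theorem eval_det_pencil_perturb_letter (l₀ : Fin 4) (d : Fin 4 → ℕ) (S : Fin 4 → Matrix (Fin 3) (Fin 3) ℝ) (E : Matrix (Fin 3) (Fin 3) ℝ) (c x : ℝ) :
    ((∑ l, (X : ℝ[X]) ^ d l • (S l + if l = l₀ then c • E else 0).map C).det).eval x
      = ((∑ l, (X : ℝ[X]) ^ d l • (S l).map C).det).eval x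
        + c * (x ^ d l₀ * ((∑ l, x ^ d l • S l).adjugate * E).trace)
        + c ^ 2 * (x ^ (2 * d l₀) * (E.adjugate * (∑ l, x ^ d l • S l)).trace)
        + c ^ 3 * (x ^ (3 * d l₀) * E.det) := by
  rw [SymmetroidDescartes.eval_det_pencil, SymmetroidDescartes.eval_det_pencil, eval_pencil_perturb_letter, det_add_smul_fin_three]
  ring

/-- the letters perturbed in `l₀` stay symmetric for symmetric `E`. [folklore] -/
theorem perturb_letter_isSymm (l₀ : Fin 4) (S : Fin 4 → Matrix (Fin 3) (Fin 3) ℝ) (hS : ∀ l, (S l).IsSymm) {E : Matrix (Fin 3) (Fin 3) ℝ}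
    (hE : E.IsSymm) (c : ℝ) (l : Fin 4) : (S l + if l = l₀ then c • E else 0).IsSymm := by
  split_ifs
  · exact (hS l).add (hE.smul c)
  · rw [add_zero]; exact hS l

/-! ## §3 Any touching root unfolds through any letter -/

/-- ★ **ANY TOUCH UNFOLDS THROUGH ANY LETTER.**  A real symmetric `(3,4)` pencil whose determinant carries an alternation chain of `N + 1` positive points and
touches zero at a flanked `ρ` admits, for every letter index `l₀`, a SYMMETRIC perturbation `S_{l₀} + c·E` with `≥ N + 2` distinct positive det-roots
(first order along `zzᵀ` off the nodes, second order along the A′-bridge diagonal direction at a node with `F(ρ) ≠ 0`, third order along `1` at `F(ρ) = 0`).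
[folklore] -/
theorem card_posRoots_perturb_letter_ge_of_touch_any (l₀ : Fin 4) (d : Fin 4 → ℕ) (S : Fin 4 → Matrix (Fin 3) (Fin 3) ℝ) (hS : ∀ l, (S l).IsSymm)
    {N : ℕ} {s : ℝ} {a : Fin (N + 1) → ℝ} (h : AltChain ((∑ l, (X : ℝ[X]) ^ d l • (S l).map C).det) N s a) (k : Fin (N + 1))
    {u ρ v : ℝ} (hu0 : 0 < u) (huρ : u < ρ) (hρv : ρ < v)
    (hlo : ∀ j : Fin (N + 1), j.val + 1 = k.val → a j < u) (hhi : ∀ j : Fin (N + 1), j.val = k.val + 1 → v < a j)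
    (hpu : 0 < (∑ l, (a k) ^ d l • S l).det * (∑ l, u ^ d l • S l).det)
    (hpρ : (∑ l, ρ ^ d l • S l).det = 0)
    (hpv : 0 < (∑ l, (a k) ^ d l • S l).det * (∑ l, v ^ d l • S l).det) :
    ∃ E : Matrix (Fin 3) (Fin 3) ℝ, E.IsSymm ∧ ∃ c : ℝ, N + 2 ≤ ((((∑ l, (X : ℝ[X]) ^ d l •
      ((S l + if l = l₀ then c • E else 0)).map C)).det).roots.toFinset.filter (fun t => 0 < t)).card := by
  set F : Matrix (Fin 3) (Fin 3) ℝ := ∑ l, ρ ^ d l • S l with hF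
  set p : ℝ[X] := (∑ l, (X : ℝ[X]) ^ d l • (S l).map C).det with hp
  have hev : ∀ t : ℝ, p.eval t = (∑ l, t ^ d l • S l).det := fun t => SymmetroidDescartes.eval_det_pencil S d t
  have hρ0 : 0 < ρ := hu0.trans huρ
  have hpu' : 0 < p.eval (a k) * p.eval u := by rwa [hev, hev]
  have hpv' : 0 < p.eval (a k) * p.eval v := by rwa [hev, hev]
  have hpρ' : p.eval ρ = 0 := by rw [hev, ← hF, hpρ]
  -- the cubic family for a given direction `E`
  have fam : ∀ E : Matrix (Fin 3) (Fin 3) ℝ, ∀ c x,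
      ((∑ l, (X : ℝ[X]) ^ d l • (S l + if l = l₀ then c • E else 0).map C).det).eval x
        = p.eval x + c * (x ^ d l₀ * ((∑ l, x ^ d l • S l).adjugate * E).trace)
          + c ^ 2 * (x ^ (2 * d l₀) * (E.adjugate * (∑ l, x ^ d l • S l)).trace) + c ^ 3 * (x ^ (3 * d l₀) * E.det) :=
    fun E c x => by rw [eval_det_pencil_perturb_letter, hp]
  by_cases hadj : F.adjugate = 0
  · by_cases hF0 : F = 0
    · -- third order along the identity
      refine ⟨1, Matrix.isSymm_one, ?_⟩
      refine le_card_posRoots_cubicFamily_of_touch₃ h k hu0 huρ hρv hlo hhi hpu' hpρ' hpv' _ _ _ _ (fam 1) ?_ ?_ ?_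
      · show ρ ^ d l₀ * ((∑ l, ρ ^ d l • S l).adjugate * 1).trace = 0
        rw [← hF, hadj, Matrix.zero_mul, Matrix.trace_zero, mul_zero]
      · show ρ ^ (2 * d l₀) * ((1 : Matrix (Fin 3) (Fin 3) ℝ).adjugate * ∑ l, ρ ^ d l • S l).trace = 0
        rw [← hF, hF0, Matrix.mul_zero, Matrix.trace_zero, mul_zero]
      · show ρ ^ (3 * d l₀) * (1 : Matrix (Fin 3) (Fin 3) ℝ).det ≠ 0
        rw [Matrix.det_one, mul_one]; exact pow_ne_zero _ hρ0.ne'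
    · -- second order at a node, A′-bridge diagonal direction
      obtain ⟨kk, hkk⟩ := exists_diag_ne_zero_of_adjugate_eq_zero (isSymm_eval_pencil d hS ρ) hadj hF0
      set σ : ℝ := -((∑ l, (a k) ^ d l • S l).det * F kk kk) with hσ
      set E : Matrix (Fin 3) (Fin 3) ℝ := Matrix.diagonal fun m : Fin 3 => if m = kk then (0 : ℝ) else if m = kk + 1 then 1 else σ with hEdef
      have hE : E.IsSymm := Matrix.isSymm_diagonal _
      have htr : (E.adjugate * F).trace = σ * F kk kk := trace_adjugate_diagonal_three_mul kk σ F
      refine ⟨E, hE, ?_⟩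
      refine le_card_posRoots_cubicFamily_of_touch₂ h k hu0 huρ hρv hlo hhi hpu' hpρ' hpv' _ _ _ _ (fam E) ?_ ?_
      · show ρ ^ d l₀ * ((∑ l, ρ ^ d l • S l).adjugate * E).trace = 0
        rw [← hF, hadj, Matrix.zero_mul, Matrix.trace_zero, mul_zero]
      · show ρ ^ (2 * d l₀) * (E.adjugate * ∑ l, ρ ^ d l • S l).trace * p.eval (a k) < 0
        rw [← hF, htr, hev, hσ]
        have h1 : 0 < ρ ^ (2 * d l₀) := pow_pos hρ0 _
        have hP : (∑ l, a k ^ d l • S l).det ≠ 0 := by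
          rw [← hev]; exact le_card_posRoots_add_C_mul_of_touch.altChain_eval_ne_zero' h k
        have h2 : 0 < ((∑ l, a k ^ d l • S l).det * F kk kk) * ((∑ l, a k ^ d l • S l).det * F kk kk) :=
          mul_self_pos.mpr (mul_ne_zero hP hkk)
        have e : ρ ^ (2 * d l₀) * (-((∑ l, a k ^ d l • S l).det * F kk kk) * F kk kk) * (∑ l, a k ^ d l • S l).det
            = -(ρ ^ (2 * d l₀) * (((∑ l, a k ^ d l • S l).det * F kk kk) * ((∑ l, a k ^ d l • S l).det * F kk kk))) := by ring
        rw [e]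
        exact neg_neg_of_pos (mul_pos h1 h2)
  · -- first order off the node, along `zzᵀ`
    have hz : ∃ z : Fin 3 → ℝ, z ⬝ᵥ (F.adjugate *ᵥ z) ≠ 0 := by
      by_contra hcon
      push Not at hcon
      exact hadj (eq_zero_of_isSymm_of_quadForm_eq_zero _ (isSymm_adjugate_eval_pencil d hS ρ) hcon)
    obtain ⟨z, hz⟩ := hz
    set E : Matrix (Fin 3) (Fin 3) ℝ := Matrix.vecMulVec z z with hEdef
    have hE : E.IsSymm := by unfold Matrix.IsSymm; ext i j; simp [hEdef, Matrix.vecMulVec_apply, mul_comm]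
    have htrE : (F.adjugate * E).trace = z ⬝ᵥ (F.adjugate *ᵥ z) := by
      simp only [hEdef, Matrix.trace, Matrix.diag, Matrix.mul_apply, Matrix.vecMulVec_apply, dotProduct, Matrix.mulVec, Fin.sum_univ_three]
      ring
    refine ⟨E, hE, ?_⟩
    refine le_card_posRoots_cubicFamily_of_touch₁ h k hu0 huρ hρv hlo hhi hpu' hpρ' hpv' _ _ _ _ (fam E) ?_
    show ρ ^ d l₀ * ((∑ l, ρ ^ d l • S l).adjugate * E).trace ≠ 0
    rw [← hF, htrE]
    exact mul_ne_zero (pow_ne_zero _ hρ0.ne') hz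

/-! ## §4 The sheets' A′ bridges (deform the middle letter `S₁`: both end letters survive) -/

/-- ★ **THE NULL-NULL SHEET'S A′ BRIDGE.**  On the null-null stratum (`det S₀ = det S₃ = 0`) a real symmetric `(3,4)` pencil whose determinant carries an
alternation chain of 16 positive points (15 crossings) and a flanked touching zero deforms — through its letter `S₁` — into a symmetric pencil STILL on the
null-null stratum with `≥ 17` distinct positive det-roots: the configuration `stub_nullNullCeiling` (`≤ 16` there) must exclude. [folklore] -/
theorem seventeen_on_nullNull_of_chain_touch_any (d : Fin 4 → ℕ) (S : Fin 4 → Matrix (Fin 3) (Fin 3) ℝ) (hS : ∀ l, (S l).IsSymm)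
    (h0 : (S 0).det = 0) (h3 : (S 3).det = 0)
    {s : ℝ} {a : Fin 16 → ℝ} (h : AltChain ((∑ l, (X : ℝ[X]) ^ d l • (S l).map C).det) 15 s a) (k : Fin 16)
    {u ρ v : ℝ} (hu0 : 0 < u) (huρ : u < ρ) (hρv : ρ < v)
    (hlo : ∀ j : Fin 16, j.val + 1 = k.val → a j < u) (hhi : ∀ j : Fin 16, j.val = k.val + 1 → v < a j)
    (hpu : 0 < (∑ l, (a k) ^ d l • S l).det * (∑ l, u ^ d l • S l).det) (hpρ : (∑ l, ρ ^ d l • S l).det = 0)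
    (hpv : 0 < (∑ l, (a k) ^ d l • S l).det * (∑ l, v ^ d l • S l).det) :
    ∃ S' : Fin 4 → Matrix (Fin 3) (Fin 3) ℝ, (∀ l, (S' l).IsSymm) ∧ (S' 0).det = 0 ∧ (S' 3).det = 0 ∧
      17 ≤ (((∑ l, (X : ℝ[X]) ^ d l • (S' l).map C).det).roots.toFinset.filter (fun t => 0 < t)).card := by
  obtain ⟨E, hE, c, h17⟩ := card_posRoots_perturb_letter_ge_of_touch_any 1 d S hS h k hu0 huρ hρv hlo hhi hpu hpρ hpv
  refine ⟨fun l => S l + if l = 1 then c • E else 0, perturb_letter_isSymm 1 S hS hE c, ?_, ?_, h17⟩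
  · show (S 0 + if (0 : Fin 4) = 1 then c • E else 0).det = 0
    rw [if_neg (by decide), add_zero, h0]
  · show (S 3 + if (3 : Fin 4) = 1 then c • E else 0).det = 0
    rw [if_neg (by decide), add_zero, h3]

/-- **The null-top sheet's A′ bridge through the middle letter** (variant of `eighteen_on_sheet_of_chain_touch_any` deforming `S₁` instead of `S₀`, so that
a null BOTTOM letter, if present, also survives). [folklore] -/
theorem eighteen_on_sheet_of_chain_touch_any' (d : Fin 4 → ℕ) (S : Fin 4 → Matrix (Fin 3) (Fin 3) ℝ) (hS : ∀ l, (S l).IsSymm)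
    (h3 : (S 3).det = 0)
    {s : ℝ} {a : Fin 17 → ℝ} (h : AltChain ((∑ l, (X : ℝ[X]) ^ d l • (S l).map C).det) 16 s a) (k : Fin 17)
    {u ρ v : ℝ} (hu0 : 0 < u) (huρ : u < ρ) (hρv : ρ < v)
    (hlo : ∀ j : Fin 17, j.val + 1 = k.val → a j < u) (hhi : ∀ j : Fin 17, j.val = k.val + 1 → v < a j)
    (hpu : 0 < (∑ l, (a k) ^ d l • S l).det * (∑ l, u ^ d l • S l).det) (hpρ : (∑ l, ρ ^ d l • S l).det = 0)
    (hpv : 0 < (∑ l, (a k) ^ d l • S l).det * (∑ l, v ^ d l • S l).det) :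
    ∃ S' : Fin 4 → Matrix (Fin 3) (Fin 3) ℝ, (∀ l, (S' l).IsSymm) ∧ (S' 3).det = 0 ∧ S' 0 = S 0 ∧
      18 ≤ (((∑ l, (X : ℝ[X]) ^ d l • (S' l).map C).det).roots.toFinset.filter (fun t => 0 < t)).card := by
  obtain ⟨E, hE, c, h18⟩ := card_posRoots_perturb_letter_ge_of_touch_any 1 d S hS h k hu0 huρ hρv hlo hhi hpu hpρ hpv
  refine ⟨fun l => S l + if l = 1 then c • E else 0, perturb_letter_isSymm 1 S hS hE c, ?_, ?_, h18⟩
  · show (S 3 + if (3 : Fin 4) = 1 then c • E else 0).det = 0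
    rw [if_neg (by decide), add_zero, h3]
  · show (S 0 + if (0 : Fin 4) = 1 then c • E else 0) = S 0
    rw [if_neg (by decide), add_zero]

end Summit.ValiantsHypothesis.ValiantsHypothesis.Theorems.LacunarySymmetroidMatrixDescartes.Census
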